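/-
Copyright: harness tree, Literature layer (sorry-free). b2b-lace enum1-g52 (ENUMERATION SHARD A gen 52),
node KU-SEP-SEED-K2: the LITERAL-READY bound of the row-truncation / coefficient-substitution error `truncErrP`
of a product-row twisted seed certificate (the product twin of `SrwTwistSeedCertRowBound`). d-generic;
number-free; what-if / input-certification lane device; no statement at any fixed dimension.
-/
import Literature.Probability.FitznerVanDerHofstad2017.SrwTwistProdCertRow
import Literature.Probability.FitznerVanDerHofstad2017.SrwTwistSeedCertRowBound
import Literature.Probability.FitznerVanDerHofstad2017.SrwFarNodeBound
import Literature.Probability.FitznerVanDerHofstad2017.SrwTwistPermSymmetry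
import HarnessLib

/-!
# Product-row twisted SEEDCERT: bounding the truncation error `truncErrP` by three scalars

`PrCert.srwTwistProdCosPow_mem_of_checkP` (module `SrwTwistProdCertRow`) brackets the product cosine-power
twisted seed `Tw^{Π_μ cos^{a_μ}}_{n+1}(m e_i; β)` by the certificate's literal interval widened by
`E = PrCert.truncErrP c D n β M`, the explicit error of
`SrwTwistProductSliceBudget.abs_srwTwist_prodCosPow_sub_prodRowObj_le` at the `μ`-independent table `c'_{μ,j} = c_j`:

`E = Σ_{k<D} C(D,k+1) (2δ)^{k+1} I_{n+1,0}(x_k) + ((α' + η)^D − α'^D)/(2π)^D · I_{n+1,0}(0)`,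

`δ = Σ_{l ≥ 0} |J_{l+J+1}(β/D)|`, `α' = Σ_{j ≤ J} ε_j ‖c_j‖`, `η = Σ_{j ≤ J} ε_j ‖2π iʲ J_j(β/D) − c_j‖`,
`x_k = ((J+1)M − a_max)(e_0 + … + e_k)`. The ONLY difference to the single-row error `TwCert.truncErrT` is the
ball radius `(J+1)M − a_max` of the truncation seeds; since plain seeds are dominated by the origin seed
(`srwI_le_srwI_zero`, `SrwFarNodeBound`: `I_{n,l}(x) ≤ I_{n,l}(0)` for `n ≥ 1`, `d ≥ 2n+1`),

* **`PrCert.truncErrP_le_truncErrT_zero`**: `truncErrP c D n β M ≤ truncErrT c.toTwCert D n β 0` for EVERY `M`;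

hence the three-scalar machinery of `SrwTwistSeedCertRowBound` applies verbatim to the product row:

* **`PrCert.truncErrP_le`**: if `δ ≤ δ̄`, `|Q_j/qden − J_j(β/D)| ≤ e` (`j ≤ J`) and `I_{n+1,0}(0) ≤ I`, then
  `E ≤ (((1 + 2δ̄)^D − 1) + ((A + (2J+1) e)^D − A^D)) · I`, `A = TwCert.absMassQ c.toTwCert`
  (`TwCert.truncErrT_zero_le`);
* **`PrCert.truncErrP_le_cast`**: `E ≤ ((TwCert.truncErrQ c.toTwCert D δ̄ e I : ℚ) : ℝ)` for rational inputs — the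
  shape a kernel-decided consumer inequality uses (`TwCert.truncErrT_zero_le_cast`);
* **`PrCert.srwTwistProdCosPow_mem_of_checkP_of_lit`**: the certified bracket of `SrwTwistProdCertRow` with `E`
  replaced by `truncErrQ` of the three rational scalars (row-budget hypothesis at its weakest point `M := c.m`:
  `c.amax ≤ (c.J+1)·c.m`);
* **ORDER-FREE forms** `PrCert.srwTwistProdCosPow_mem_of_checkP_perm` / `PrCert.srwTwistProdCosPow_mem_of_checkP_of_lit_perm`:
  the same brackets for EVERY exponent vector `b` whose value list is a REARRANGEMENT of the unrolled class list
  (`(List.ofFn b).Perm (unroll c.cls)`, kernel-decidable for literal `b`) — the product cosine-power seed depends on `b`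
  only through its multiset of values (`srwTwist_prodCosPow_eq_of_ofFn_perm`, module `SrwTwistPermSymmetry`), so ONE
  certificate per partition shape serves all placements of the exponents among the coordinates
  (helper `exists_ofFn_eq_of_ofFn_perm`).

Everything is PROVED (standard axioms), generic in the dimension and number-free; no definition, no instance,
no named fact. Epistemic status / lane: what-if / input-certification SUPPORT; nothing here is a certificate;
no statement at a specific dimension.

## References
* R. Fitzner, R. van der Hofstad, *Generalized approach to the non-backtracking lace expansion*,
  PTRF 169 (2017) 1041–1119 (arXiv:1506.07969), (3.34)–(3.38) p. 1071, §5.1.1 (5.2)–(5.5) pp. 1089–1090.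
  [FitznerVanDerHofstad2016NoBLE]
* T. Hara, G. Slade, *The lace expansion for self-avoiding walk in five or more dimensions*,
  Rev. Math. Phys. 4 (1992), App. B Lemma B.3 (monotonicity of the plain seeds). [HaraSlade1992b]
[cite: FitznerVanDerHofstad2016NoBLE, §5.1.1 (5.2)–(5.5) pp. 1089–1090]
-/

set_option Elab.async false

namespace Literature.Probability.FitznerVanDerHofstad2017.SeedCert

open Real MeasureTheory Set Finset
open Literature.Probability.LatticeModels (besselI)
open Literature.Analysis.FunctionSpaces (besselJ)
open scoped Nat

namespace PrCert

variable (c : PrCert) (D : ℕ)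

/-- **The product-row truncation error is dominated by the single-row error at `M = 0`:**
`truncErrP c D n β M ≤ truncErrT c.toTwCert D n β 0` for every `M` (termwise: the truncation seeds
`I_{n+1,0}(((J+1)M − a_max)(e_0+…+e_k)) ≤ I_{n+1,0}(0)` by `srwI_le_srwI_zero`; the coefficient term is identical).
[cite: FitznerVanDerHofstad2016NoBLE, §5.1.1 (5.2)–(5.5) pp. 1089–1090] -/
theorem truncErrP_le_truncErrT_zero (n : ℕ) (hD : 2 * (n + 1) + 1 ≤ D) (β : ℝ) (M : ℕ) :
    c.truncErrP D n β M ≤ c.toTwCert.truncErrT D n β 0 := by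
  simp only [truncErrP, TwCert.truncErrT]
  refine add_le_add (Finset.sum_le_sum fun k _ => ?_) le_rfl
  have hδ : 0 ≤ (D.choose (k + 1) : ℝ) * (2 * ∑' l : ℕ, |besselJ (l + c.J + 1) (β / D)|) ^ (k + 1) :=
    mul_nonneg (Nat.cast_nonneg _)
      (pow_nonneg (mul_nonneg zero_le_two (tsum_nonneg fun _ => abs_nonneg _)) _)
  refine mul_le_mul_of_nonneg_left ?_ hδ
  have hfun : (fun μ : Fin D => if (μ : ℕ) < k + 1 then ((((c.J + 1) * 0 : ℕ)) : ℤ) else 0)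
      = (0 : Fin D → ℤ) := by
    funext μ; simp
  rw [hfun]
  exact srwI_le_srwI_zero (by omega) hD 0 _

/-- **`truncErrP` from three scalars** (every `M`). For `2(n+1)+1 ≤ D`, `0 < qden`: if the Bessel-`J` order tail is
`≤ δ̄`, every literal weight is within `e` of `J_j(β/D)` (`j ≤ J`), and the origin seed `I_{n+1,0}(0) ≤ I`, then
`truncErrP c D n β M ≤ (((1+2δ̄)^D − 1) + ((A + (2J+1)e)^D − A^D)) · I`, `A = absMassQ c.toTwCert`.
[cite: FitznerVanDerHofstad2016NoBLE, §5.1.1 (5.2)–(5.5) pp. 1089–1090] -/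
theorem truncErrP_le (n : ℕ) (hD : 2 * (n + 1) + 1 ≤ D) (hq : 0 < c.qden) (β : ℝ) (M : ℕ)
    {δb e I : ℝ}
    (hδ : ∑' l : ℕ, |besselJ (l + c.J + 1) (β / D)| ≤ δb)
    (he : ∀ j ∈ Finset.range (c.J + 1), |((c.Q j : ℤ) : ℝ) / (c.qden : ℝ) - besselJ j (β / D)| ≤ e)
    (hI : srwI D (n + 1) 0 (fun _ : Fin D => 0) ≤ I) :
    c.truncErrP D n β M
      ≤ (((1 + 2 * δb) ^ D - 1)
          + ((((c.toTwCert.absMassQ : ℚ) : ℝ) + (2 * c.J + 1) * e) ^ D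
              - ((c.toTwCert.absMassQ : ℚ) : ℝ) ^ D)) * I :=
  (c.truncErrP_le_truncErrT_zero D n hD β M).trans (c.toTwCert.truncErrT_zero_le D n hD hq β hδ he hI)

/-- **Rational inputs:** `truncErrP c D n β M ≤ ((truncErrQ c.toTwCert D δ̄ e I : ℚ) : ℝ)` — the shape consumed by a
kernel-decided literal inequality. [cite: FitznerVanDerHofstad2016NoBLE, §5.1.1 (5.2)–(5.5) pp. 1089–1090] -/
theorem truncErrP_le_cast (n : ℕ) (hD : 2 * (n + 1) + 1 ≤ D) (hq : 0 < c.qden) (β : ℝ) (M : ℕ)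
    {δb e I : ℚ}
    (hδ : ∑' l : ℕ, |besselJ (l + c.J + 1) (β / D)| ≤ (δb : ℝ))
    (he : ∀ j ∈ Finset.range (c.J + 1), |((c.Q j : ℤ) : ℝ) / (c.qden : ℝ) - besselJ j (β / D)| ≤ (e : ℝ))
    (hI : srwI D (n + 1) 0 (fun _ : Fin D => 0) ≤ (I : ℝ)) :
    c.truncErrP D n β M ≤ ((c.toTwCert.truncErrQ D δb e I : ℚ) : ℝ) :=
  (c.truncErrP_le_truncErrT_zero D n hD β M).trans (c.toTwCert.truncErrT_zero_le_cast D n hD hq β hδ he hI)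

/-- **Certified bracket with the literal-ready error.** If `c.checkP D` passes, then for every exponent vector
`a` unrolling the class list, `n ≤ 3` with `2(n+1)+1 ≤ D`, axis `i`, `β`, provided `c.amax ≤ (c.J+1)·c.m` (the
row-budget hypothesis at its weakest point `M := c.m`; decidable for a literal certificate), and rational scalars
`δ̄, e, I` dominating the Bessel-`J` order tail, the literal weight errors and the origin seed:
`lo (n+1) − truncErrQ ≤ Tw^{Π_μ cos^{a_μ}}_{n+1}(c.m · e_i; β) ≤ hi (n+1) + truncErrQ`.
[cite: FitznerVanDerHofstad2016NoBLE, §5.1.1 (5.2)–(5.5) pp. 1089–1090] -/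
theorem srwTwistProdCosPow_mem_of_checkP_of_lit (h : c.checkP D = true) (a : Fin D → ℕ)
    (ha : List.ofFn a = unroll c.cls) (n : ℕ) (hn : n ≤ 3) (hd : 2 * (n + 1) + 1 ≤ D) (i : Fin D)
    (β : ℝ) (hamax : c.amax ≤ (c.J + 1) * c.m) {δb e I : ℚ}
    (hδ : ∑' l : ℕ, |besselJ (l + c.J + 1) (β / D)| ≤ (δb : ℝ))
    (he : ∀ j ∈ Finset.range (c.J + 1), |((c.Q j : ℤ) : ℝ) / (c.qden : ℝ) - besselJ j (β / D)| ≤ (e : ℝ))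
    (hI : srwI D (n + 1) 0 (fun _ : Fin D => 0) ≤ (I : ℝ)) :
    ((c.lo (n + 1) : ℚ) : ℝ) - ((c.toTwCert.truncErrQ D δb e I : ℚ) : ℝ)
        ≤ srwTwist D (n + 1) (fun k => ∏ μ, Real.cos (k μ) ^ a μ) (Pi.single i (c.m : ℤ)) β ∧
    srwTwist D (n + 1) (fun k => ∏ μ, Real.cos (k μ) ^ a μ) (Pi.single i (c.m : ℤ)) β
        ≤ ((c.hi (n + 1) : ℚ) : ℝ) + ((c.toTwCert.truncErrQ D δb e I : ℚ) : ℝ) := by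
  obtain ⟨h1, -, -, -, -⟩ := c.checkP_spec D h
  have hq : 0 < c.qden := (c.paramsP_of_paramsOKP D h1).toT.qden_pos
  have hE := c.truncErrP_le_cast D n hd hq β c.m hδ he hI
  obtain ⟨hl, hr⟩ := c.srwTwistProdCosPow_mem_of_checkP D h a ha n hn hd i β c.m le_rfl hamax
  constructor <;> linarith

end PrCert

/-- A function `b : Fin D → ℕ` whose value list is a rearrangement of a list `l` has a companion `a` unrolling `l`
itself (`List.ofFn a = l`) with `List.ofFn b ~ List.ofFn a` — the bridge from the order-free hypothesis to the
certificate's unrolled class list. [cite: FitznerVanDerHofstad2016NoBLE, §5.1.1 (5.2)–(5.5) pp. 1089–1090] -/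
theorem exists_ofFn_eq_of_ofFn_perm (D : ℕ) {l : List ℕ} (b : Fin D → ℕ) (hb : (List.ofFn b).Perm l) :
    ∃ a : Fin D → ℕ, List.ofFn a = l ∧ (List.ofFn b).Perm (List.ofFn a) := by
  have hl : l.length = D := by rw [← hb.length_eq, List.length_ofFn]
  refine ⟨fun μ => l[(μ : ℕ)]'(by omega), ?_⟩
  have ha : List.ofFn (fun μ : Fin D => l[(μ : ℕ)]'(by omega)) = l :=
    List.ext_getElem (by simp [hl]) (fun i h₁ h₂ => by simp [List.getElem_ofFn])
  exact ⟨ha, by rw [ha]; exact hb⟩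

namespace PrCert

variable (c : PrCert) (D : ℕ)

/-- **ORDER-FREE certified bracket.** If `c.checkP D` passes, then for EVERY exponent vector `b` whose value list is
a rearrangement of the unrolled class list (`List.ofFn b ~ unroll c.cls`), `n ≤ 3` with `2(n+1)+1 ≤ D`, axis `i`,
`β`, and `M ≤ c.m` with `c.amax ≤ (c.J+1) M`:
`lo (n+1) − truncErrP ≤ Tw^{Π_μ cos^{b_μ}}_{n+1}(c.m · e_i; β) ≤ hi (n+1) + truncErrP`
(`srwTwistProdCosPow_mem_of_checkP` transported along `srwTwist_prodCosPow_eq_of_ofFn_perm`).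
[cite: FitznerVanDerHofstad2016NoBLE, §5.1.1 (5.2)–(5.5) pp. 1089–1090] -/
theorem srwTwistProdCosPow_mem_of_checkP_perm (h : c.checkP D = true) (b : Fin D → ℕ)
    (hb : (List.ofFn b).Perm (unroll c.cls)) (n : ℕ) (hn : n ≤ 3) (hd : 2 * (n + 1) + 1 ≤ D) (i : Fin D)
    (β : ℝ) (M : ℕ) (hM : M ≤ c.m) (hamax : c.amax ≤ (c.J + 1) * M) :
    ((c.lo (n + 1) : ℚ) : ℝ) - c.truncErrP D n β M
        ≤ srwTwist D (n + 1) (fun k => ∏ μ, Real.cos (k μ) ^ b μ) (Pi.single i (c.m : ℤ)) β ∧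
    srwTwist D (n + 1) (fun k => ∏ μ, Real.cos (k μ) ^ b μ) (Pi.single i (c.m : ℤ)) β
        ≤ ((c.hi (n + 1) : ℚ) : ℝ) + c.truncErrP D n β M := by
  obtain ⟨a, ha, hab⟩ := exists_ofFn_eq_of_ofFn_perm D b hb
  rw [srwTwist_prodCosPow_eq_of_ofFn_perm b a hab]
  exact c.srwTwistProdCosPow_mem_of_checkP D h a ha n hn hd i β M hM hamax

/-- **ORDER-FREE certified bracket with the literal-ready error** (`srwTwistProdCosPow_mem_of_checkP_of_lit`
transported along `srwTwist_prodCosPow_eq_of_ofFn_perm`): for every rearrangement `b` of the unrolled class list,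
`lo (n+1) − truncErrQ ≤ Tw^{Π_μ cos^{b_μ}}_{n+1}(c.m · e_i; β) ≤ hi (n+1) + truncErrQ`.
[cite: FitznerVanDerHofstad2016NoBLE, §5.1.1 (5.2)–(5.5) pp. 1089–1090] -/
theorem srwTwistProdCosPow_mem_of_checkP_of_lit_perm (h : c.checkP D = true) (b : Fin D → ℕ)
    (hb : (List.ofFn b).Perm (unroll c.cls)) (n : ℕ) (hn : n ≤ 3) (hd : 2 * (n + 1) + 1 ≤ D) (i : Fin D)
    (β : ℝ) (hamax : c.amax ≤ (c.J + 1) * c.m) {δb e I : ℚ}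
    (hδ : ∑' l : ℕ, |besselJ (l + c.J + 1) (β / D)| ≤ (δb : ℝ))
    (he : ∀ j ∈ Finset.range (c.J + 1), |((c.Q j : ℤ) : ℝ) / (c.qden : ℝ) - besselJ j (β / D)| ≤ (e : ℝ))
    (hI : srwI D (n + 1) 0 (fun _ : Fin D => 0) ≤ (I : ℝ)) :
    ((c.lo (n + 1) : ℚ) : ℝ) - ((c.toTwCert.truncErrQ D δb e I : ℚ) : ℝ)
        ≤ srwTwist D (n + 1) (fun k => ∏ μ, Real.cos (k μ) ^ b μ) (Pi.single i (c.m : ℤ)) β ∧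
    srwTwist D (n + 1) (fun k => ∏ μ, Real.cos (k μ) ^ b μ) (Pi.single i (c.m : ℤ)) β
        ≤ ((c.hi (n + 1) : ℚ) : ℝ) + ((c.toTwCert.truncErrQ D δb e I : ℚ) : ℝ) := by
  obtain ⟨a, ha, hab⟩ := exists_ofFn_eq_of_ofFn_perm D b hb
  rw [srwTwist_prodCosPow_eq_of_ofFn_perm b a hab]
  exact c.srwTwistProdCosPow_mem_of_checkP_of_lit D h a ha n hn hd i β hamax hδ he hI

end PrCert

end Literature.Probability.FitznerVanDerHofstad2017.SeedCert
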